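import Summits.Ventures.CertifiedManyBodySolver.Theorems.M3x2EdgeSplitSymReplayNormalWords

/-!
# SymReplay checker — S7 PROVED: NORMAL WORDS ARE LINEARLY INDEPENDENT (part 2 of 2)

Team lb-sym (cell hub-lb), hub-lb-sym-eng-4 g1.  `NormalWordsIndependent` — stated VERBATIM as in
`Cruxes/LowerEdge_ge_m83o100/Lines/symreplay.lean` (hub-lb-sym-plan-1, optional support stub S7 of the line «symreplay»;
stmt-Ventures-22024 / twin 21721): a polynomial of pairwise distinct `nfWord`-fixed words supported in `Λ'` that evaluates
to `0` in `𝔄_{Λ'} = FermionOp Λ'` has all coefficients `0`.  This is the UNIQUENESS half of the CAR normal form that S1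
(`NfFaithful`, existence/faithfulness) lacks; with it `collect ∘ nfPoly` is a canonical form (Bratteli–Robinson II §5.2.2;
Tasaki 2020 §9.2).  PROOF: a normal word is a sorted creator block `cs` followed by a sorted annihilator block `as`
(`normal_split`); its operator is `(Π c†_{orbs cs}) (Π c_{orbs as})` (`wordOp_creAnn`), whose `⟨B|·|A⟩` entry is nonzero only
for `orbs as ⊆ A`, `B = orbs cs ∪ (A ∖ orbs as)` (part 1), and IS nonzero at `(B, A) = (orbs cs, orbs as)`; reading the
`(orbs cs, orbs as)` entry of `polyOp p = 0` for a word of MINIMAL length among the nonzero coefficients, every other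
contributor has annihilator set `Q' ⊊ Q` hence is strictly shorter (coefficient `0` by induction), or has the same orbital
sets and then is the SAME word (`eq_of_orbs_toFinset_eq`: a `modeLt`-sorted block is determined by its orbital set) —
excluded by pairwise distinctness; so the minimal coefficient vanishes too (`coeff_zero_step`, `stub_normalWordsIndependent`).
It supports the item without closing it (S7 is outside the composition `LowerEdge_ge_*_of`); S8 `MoveEquivariant` follows
from it together with the landed `moveOp_equivariant` (not done here).
No summit statement is proved here; nothing here predicts superconductivity.
-/

noncomputable section

namespace Summit.Ventures.CertifiedManyBodySolver.Theorems.SymReplay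

open Matrix Finset
open Literature.MathematicalPhysics.QuantumLattice
open Literature.MathematicalPhysics.QuantumLattice.HubbardWave0
open Literature.Probability.LatticeModels (Site)

section Indep

open Literature.Probability.LatticeModels

variable (Λ' : Finset (Site 2))

/-! ## Orbitals of letters and words in the frame -/

/-- The orbital of a letter lying in the frame. -/
def lorb (ℓ : Letter) (h : ℓ.x ∈ Λ') : Orb (PolySite Λ') := orb (PolySite.pt ℓ.x h) ℓ.s

/-- The orbitals of a word supported in the frame, in order. -/
def orbs (l : Word) (hl : SuppIn l Λ') : List (Orb (PolySite Λ')) := l.pmap (fun ℓ h => lorb Λ' ℓ h) hl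

/-- `orbs` of the empty word. -/
theorem orbs_nil (h : SuppIn [] Λ') : orbs Λ' [] h = [] := rfl

/-- `orbs` of a cons. -/
theorem orbs_cons (a : Letter) (l : Word) (h : SuppIn (a :: l) Λ') :
    orbs Λ' (a :: l) h = lorb Λ' a (h a List.mem_cons_self) :: orbs Λ' l (fun x hx => h x (List.mem_cons_of_mem a hx)) := by
  simp [orbs, List.pmap]

/-- `orbs` preserves length. -/
theorem length_orbs (l : Word) (hl : SuppIn l Λ') : (orbs Λ' l hl).length = l.length := by
  simp [orbs]

/-- Membership in `orbs`. -/
theorem mem_orbs {l : Word} {hl : SuppIn l Λ'} {o : Orb (PolySite Λ')} :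
    o ∈ orbs Λ' l hl ↔ ∃ ℓ, ∃ (hℓ : ℓ ∈ l), o = lorb Λ' ℓ (hl ℓ hℓ) := by
  simp only [orbs, List.mem_pmap]
  constructor
  · rintro ⟨ℓ, hℓ, h⟩; exact ⟨ℓ, hℓ, h.symm⟩
  · rintro ⟨ℓ, hℓ, h⟩; exact ⟨ℓ, hℓ, h.symm⟩

/-- Same orbital iff same mode. -/
theorem lorb_eq_iff (a b : Letter) (ha : a.x ∈ Λ') (hb : b.x ∈ Λ') :
    lorb Λ' a ha = lorb Λ' b hb ↔ a.modeEq b = true := (modeEq_iff a b ha hb).symm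

/-- `modeLt`-related letters have different orbitals. -/
theorem lorb_ne_of_modeLt {a b : Letter} (ha : a.x ∈ Λ') (hb : b.x ∈ Λ') (h : a.modeLt b = true) :
    lorb Λ' a ha ≠ lorb Λ' b hb := by
  intro heq
  have := modeLt_irrefl_of_modeEq ((lorb_eq_iff Λ' a b ha hb).1 heq)
  rw [this] at h
  exact Bool.false_ne_true h

/-- A `modeLt`-chain of letters has duplicate-free orbitals. -/
theorem nodup_orbs (l : Word) (hl : SuppIn l Λ') (hp : l.Pairwise (fun a b => a.modeLt b = true)) :
    (orbs Λ' l hl).Nodup := by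
  unfold orbs List.Nodup
  rw [List.pairwise_pmap]
  exact hp.imp_of_mem (fun {a b} ha hb hab h1 h2 => lorb_ne_of_modeLt Λ' h1 h2 hab)

/-- Creators in the frame act as `creation` of their orbitals. -/
theorem map_letterOp_cre (l : Word) (hl : SuppIn l Λ') (hd : ∀ ℓ ∈ l, ℓ.dag = true) :
    l.map (letterOp Λ') = (orbs Λ' l hl).map creation := by
  induction l with
  | nil => rfl
  | cons a l ih =>
    rw [List.map_cons, orbs_cons, List.map_cons, ih (fun x hx => hl x (List.mem_cons_of_mem a hx))
      (fun x hx => hd x (List.mem_cons_of_mem a hx)), letterOp_of_mem Λ' a (hl a List.mem_cons_self),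
      hd a List.mem_cons_self]
    simp [ladderLetter, lorb]

/-- Annihilators in the frame act as `annihilation` of their orbitals. -/
theorem map_letterOp_ann (l : Word) (hl : SuppIn l Λ') (hd : ∀ ℓ ∈ l, ℓ.dag = false) :
    l.map (letterOp Λ') = (orbs Λ' l hl).map annihilation := by
  induction l with
  | nil => rfl
  | cons a l ih =>
    rw [List.map_cons, orbs_cons, List.map_cons, ih (fun x hx => hl x (List.mem_cons_of_mem a hx))
      (fun x hx => hd x (List.mem_cons_of_mem a hx)), letterOp_of_mem Λ' a (hl a List.mem_cons_self),
      hd a List.mem_cons_self]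
    simp [ladderLetter, lorb]

/-- The operator of a creators-then-annihilators word in Fock form. -/
theorem wordOp_creAnn (cs az : Word) (hcs : SuppIn cs Λ') (has : SuppIn az Λ')
    (hc : ∀ ℓ ∈ cs, ℓ.dag = true) (ha : ∀ ℓ ∈ az, ℓ.dag = false) :
    wordOp Λ' (cs ++ az) = ((orbs Λ' cs hcs).map creation).prod * ((orbs Λ' az has).map annihilation).prod := by
  rw [wordOp, List.map_append, List.prod_append, map_letterOp_cre Λ' cs hcs hc, map_letterOp_ann Λ' az has ha]

/-! ## Sorted letter blocks are determined by their orbital sets -/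

/-- `modeEq` is reflexive. -/
theorem modeEq_refl (a : Letter) : a.modeEq a = true := by
  rw [modeEq_iff']; exact ⟨⟨rfl, rfl⟩, rfl⟩

/-- `modeEq` is symmetric. -/
theorem modeEq_symm {a b : Letter} (h : a.modeEq b = true) : b.modeEq a = true := by
  rw [modeEq_iff'] at h ⊢; exact ⟨⟨h.1.1.symm, h.1.2.symm⟩, h.2.symm⟩

/-- `modeLt` is compatible with `modeEq` on the right. -/
theorem modeLt_of_modeLt_of_modeEq {a b c : Letter} (h1 : a.modeLt b = true) (h2 : b.modeEq c = true) :
    a.modeLt c = true := by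
  rw [modeLt_iff] at h1 ⊢; rw [modeEq_iff'] at h2
  have hs : b.s.val = c.s.val := by rw [h2.2]
  omega

/-- `modeLt` is irreflexive. -/
theorem modeLt_irrefl (a : Letter) : a.modeLt a = false := modeLt_irrefl_of_modeEq (modeEq_refl a)

/-- Letters with the same mode and the same dagger flag are equal. -/
theorem letter_eq_of_modeEq {a b : Letter} (h : a.modeEq b = true) (hd : a.dag = b.dag) : a = b := by
  have h' := h
  simp only [Letter.modeEq, Bool.and_eq_true, beq_iff_eq, siteEq_iff] at h'
  cases a; cases b
  simp only [Letter.mk.injEq]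
  exact ⟨h'.1, h'.2, hd⟩

/-- **Two `modeLt`-sorted letter blocks of one dagger kind with the same orbital set are the same word.** -/
theorem eq_of_orbs_toFinset_eq (d : Bool) :
    ∀ (l l' : Word) (hl : SuppIn l Λ') (hl' : SuppIn l' Λ'),
      (∀ ℓ ∈ l, ℓ.dag = d) → (∀ ℓ ∈ l', ℓ.dag = d) → l.Pairwise MLt → l'.Pairwise MLt →
      (orbs Λ' l hl).toFinset = (orbs Λ' l' hl').toFinset → l = l' := by
  intro l
  induction l with
  | nil =>
    intro l' hl hl' _ _ _ _ heq
    rw [orbs_nil, List.toFinset_nil, eq_comm, List.toFinset_eq_empty_iff] at heq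
    have := length_orbs Λ' l' hl'
    rw [heq, List.length_nil] at this
    exact (List.eq_nil_of_length_eq_zero this.symm).symm
  | cons c rest ih =>
    intro l' hl hl' hd hd' hp hp' heq
    cases l' with
    | nil =>
      exfalso
      rw [orbs_nil, List.toFinset_nil, List.toFinset_eq_empty_iff] at heq
      have := length_orbs Λ' (c :: rest) hl
      rw [heq] at this
      simp at this
    | cons c' rest' =>
      have hc : c.x ∈ Λ' := hl c List.mem_cons_self
      have hc' : c'.x ∈ Λ' := hl' c' List.mem_cons_self
      have hrest : SuppIn rest Λ' := fun x hx => hl x (List.mem_cons_of_mem c hx)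
      have hrest' : SuppIn rest' Λ' := fun x hx => hl' x (List.mem_cons_of_mem c' hx)
      rw [orbs_cons, orbs_cons, List.toFinset_cons, List.toFinset_cons] at heq
      -- the orbital of `c` occurs in `c' :: rest'` and vice versa
      have h1 : lorb Λ' c hc ∈ insert (lorb Λ' c' hc') (orbs Λ' rest' hrest').toFinset := by
        rw [← heq]; exact Finset.mem_insert_self _ _
      have h2 : lorb Λ' c' hc' ∈ insert (lorb Λ' c hc) (orbs Λ' rest hrest).toFinset := by
        rw [heq]; exact Finset.mem_insert_self _ _
      -- `c` and `c'` have the same mode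
      have hcc : c.modeEq c' = true := by
        rcases Finset.mem_insert.1 h1 with h1 | h1
        · exact (lorb_eq_iff Λ' c c' hc hc').1 h1
        · exfalso
          rw [List.mem_toFinset, mem_orbs] at h1
          obtain ⟨d', hd'm, hd'e⟩ := h1
          -- c' < d' and d' ~ c  ⇒  c' < c
          have hlt1 : c'.modeLt c = true :=
            modeLt_of_modeLt_of_modeEq (List.rel_of_pairwise_cons hp' hd'm)
              (modeEq_symm ((lorb_eq_iff Λ' c d' hc (hrest' d' hd'm)).1 hd'e))
          rcases Finset.mem_insert.1 h2 with h2 | h2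
          · have := modeLt_irrefl_of_modeEq ((lorb_eq_iff Λ' c' c hc' hc).1 h2)
            rw [this] at hlt1; exact Bool.false_ne_true hlt1
          · rw [List.mem_toFinset, mem_orbs] at h2
            obtain ⟨d, hdm, hde⟩ := h2
            -- c < d and d ~ c'  ⇒  c < c'  ⇒  c < c, absurd
            have hlt2 : c.modeLt c' = true :=
              modeLt_of_modeLt_of_modeEq (List.rel_of_pairwise_cons hp hdm)
                (modeEq_symm ((lorb_eq_iff Λ' c' d hc' (hrest d hdm)).1 hde))
            have := modeLt_trans hlt2 hlt1
            rw [modeLt_irrefl] at this; exact Bool.false_ne_true this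
      have hceq : c = c' := letter_eq_of_modeEq hcc (by rw [hd c List.mem_cons_self, hd' c' List.mem_cons_self])
      subst hceq
      have ho : lorb Λ' c hc = lorb Λ' c hc' := rfl
      -- peel the common head off the orbital sets
      have hn : lorb Λ' c hc ∉ (orbs Λ' rest hrest).toFinset := by
        rw [List.mem_toFinset, mem_orbs]
        rintro ⟨d, hdm, hde⟩
        exact lorb_ne_of_modeLt Λ' hc (hrest d hdm) (List.rel_of_pairwise_cons hp hdm) hde
      have hn' : lorb Λ' c hc' ∉ (orbs Λ' rest' hrest').toFinset := by
        rw [List.mem_toFinset, mem_orbs]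
        rintro ⟨d, hdm, hde⟩
        exact lorb_ne_of_modeLt Λ' hc' (hrest' d hdm) (List.rel_of_pairwise_cons hp' hdm) hde
      have hsets : (orbs Λ' rest hrest).toFinset = (orbs Λ' rest' hrest').toFinset := by
        have := congrArg (fun s => Finset.erase s (lorb Λ' c hc)) heq
        simpa only [Finset.erase_insert hn, ho, Finset.erase_insert hn'] using this
      rw [ih rest' hrest hrest' (fun x hx => hd x (List.mem_cons_of_mem c hx))
        (fun x hx => hd' x (List.mem_cons_of_mem c hx)) (List.Pairwise.of_cons hp) (List.Pairwise.of_cons hp') hsets]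

/-! ## Entries of `polyOp` and the independence theorem -/

/-- Matrix entries of `polyOp`. -/
theorem polyOp_apply (p : QPoly) (i j : Finset (Orb (PolySite Λ'))) :
    (polyOp Λ' p) i j = (p.map fun t => ((t.1 : ℚ) : ℂ) * (wordOp Λ' t.2) i j).sum := by
  induction p with
  | nil => simp
  | cons t p ih => rw [polyOp_cons, Matrix.add_apply, Matrix.smul_apply, smul_eq_mul, ih, List.map_cons, List.sum_cons]

/-- **S7 statement** (verbatim from `Cruxes/LowerEdge_ge_m83o100/Lines/symreplay.lean`): normal words are linearly
independent — a polynomial of pairwise distinct `nfWord`-fixed words supported in `Λ'` that evaluates to `0`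
in `𝔄_{Λ'}` has all coefficients `0`. -/
def NormalWordsIndependent : Prop :=
  ∀ (Λ' : Finset (Site 2)) (p : QPoly),
    (∀ t ∈ p, SuppIn t.2 Λ' ∧ nfWord t.2 = [(1, t.2)]) →
    p.Pairwise (fun s t => wordEq s.2 t.2 = false) →
    polyOp Λ' p = 0 → ∀ t ∈ p, t.1 = 0

end Indep

section Proof

open Literature.Probability.LatticeModels

/-- Core step: in a polynomial of pairwise-distinct normal words evaluating to `0`, if every word SHORTER than the
normal word `cs ++ az` has coefficient `0`, then so does `cs ++ az` — read off at the matrix entry `⟨cs| · |az⟩`. -/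
theorem coeff_zero_step (Λ' : Finset (Site 2)) (p : QPoly)
    (hp : ∀ t ∈ p, SuppIn t.2 Λ' ∧ nfWord t.2 = [(1, t.2)])
    (hpw : p.Pairwise (fun s t => wordEq s.2 t.2 = false)) (h0 : polyOp Λ' p = 0)
    (n : ℕ) (ih : ∀ t ∈ p, t.2.length < n → t.1 = 0) :
    ∀ t ∈ p, t.2.length = n → t.1 = 0 := by
  intro t ht hlen
  obtain ⟨hsupp, hnf⟩ := hp t ht
  obtain ⟨cs, az, hw, hc, ha, hpc, hpa⟩ := normal_split t.2 (normal_of_nfWord_eq t.2 hnf)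
  have hcs : SuppIn cs Λ' := fun x hx => hsupp x (by rw [hw]; exact List.mem_append_left _ hx)
  have has : SuppIn az Λ' := fun x hx => hsupp x (by rw [hw]; exact List.mem_append_right _ hx)
  set P := (orbs Λ' cs hcs).toFinset with hP
  set Q := (orbs Λ' az has).toFinset with hQ
  have hPn := nodup_orbs Λ' cs hcs hpc
  have hQn := nodup_orbs Λ' az has hpa
  -- the (P, Q) entry of `polyOp p = 0`
  have hentry : (p.map fun t' => ((t'.1 : ℚ) : ℂ) * (wordOp Λ' t'.2) P Q).sum = 0 := by
    rw [← polyOp_apply, h0]; rfl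
  -- every OTHER term vanishes
  have hothers : ∀ t' ∈ p, t' ≠ t → wordEq t'.2 t.2 = false ∨ wordEq t.2 t'.2 = false →
      ((t'.1 : ℚ) : ℂ) * (wordOp Λ' t'.2) P Q = 0 := by
    intro t' ht' _ hne
    have hne' : t'.2 ≠ t.2 := by
      rcases hne with hne | hne <;> intro heq
      · rw [heq, (wordEq_iff _ _).2 rfl] at hne; exact Bool.noConfusion hne
      · rw [← heq, (wordEq_iff _ _).2 rfl] at hne; exact Bool.noConfusion hne
    by_cases hM : (wordOp Λ' t'.2) P Q = 0
    · rw [hM, mul_zero]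
    · -- the entry is nonzero: read off the occupation pattern of t'
      obtain ⟨hsupp', hnf'⟩ := hp t' ht'
      obtain ⟨cs', az', hw', hc', ha', hpc', hpa'⟩ := normal_split t'.2 (normal_of_nfWord_eq t'.2 hnf')
      have hcs' : SuppIn cs' Λ' := fun x hx => hsupp' x (by rw [hw']; exact List.mem_append_left _ hx)
      have has' : SuppIn az' Λ' := fun x hx => hsupp' x (by rw [hw']; exact List.mem_append_right _ hx)
      have hPn' := nodup_orbs Λ' cs' hcs' hpc'
      have hQn' := nodup_orbs Λ' az' has' hpa'
      rw [hw', wordOp_creAnn Λ' cs' az' hcs' has' hc' ha'] at hM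
      obtain ⟨hq, hpp, hPeq⟩ := creAnn_apply_ne_zero _ _ hPn' hQn' Q P hM
      set P' := (orbs Λ' cs' hcs').toFinset with hP'
      set Q' := (orbs Λ' az' has').toFinset with hQ'
      have hQsub : Q' ⊆ Q := fun o ho => hq o (List.mem_toFinset.1 ho)
      have hdisj : Disjoint P' (Q \ Q') := by
        rw [Finset.disjoint_left]
        intro o ho
        exact hpp o (List.mem_toFinset.1 ho)
      -- cardinalities
      have hcardP : P.card = P'.card + (Q \ Q').card := by
        rw [hPeq, Finset.card_union_of_disjoint hdisj]
      have hcardQ : (Q \ Q').card + Q'.card = Q.card := Finset.card_sdiff_add_card_eq_card hQsub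
      have hlen : t.2.length = P.card + Q.card := by
        rw [hw, List.length_append, hP, hQ, List.toFinset_card_of_nodup hPn, List.toFinset_card_of_nodup hQn,
          length_orbs, length_orbs]
      have hlen' : t'.2.length = P'.card + Q'.card := by
        rw [hw', List.length_append, hP', hQ', List.toFinset_card_of_nodup hPn', List.toFinset_card_of_nodup hQn',
          length_orbs, length_orbs]
      by_cases hQeq : Q' = Q
      · -- same annihilator set ⇒ same creator set ⇒ same word: excluded
        exfalso
        have hPP : P = P' := by rw [hPeq, hQeq, Finset.sdiff_self, Finset.union_empty]
        have hcs_eq : cs' = cs :=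
          eq_of_orbs_toFinset_eq Λ' true cs' cs hcs' hcs hc' hc hpc' hpc (by rw [← hP', ← hP, hPP])
        have has_eq : az' = az :=
          eq_of_orbs_toFinset_eq Λ' false az' az has' has ha' ha hpa' hpa (by rw [← hQ', ← hQ, hQeq])
        exact hne' (by rw [hw', hw, hcs_eq, has_eq])
      · -- strictly fewer annihilator orbitals ⇒ strictly shorter ⇒ coefficient 0 by hypothesis
        have hlt : Q'.card < Q.card := Finset.card_lt_card (Finset.ssubset_iff_subset_ne.2 ⟨hQsub, hQeq⟩)
        have hshort : t'.2.length < n := by omega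
        rw [ih t' ht' hshort, Rat.cast_zero, zero_mul]
  -- split the list at `t`
  obtain ⟨p₁, p₂, rfl⟩ := List.append_of_mem ht
  rw [List.map_append, List.map_cons, List.sum_append, List.sum_cons] at hentry
  have hp₁ : (p₁.map fun t' => ((t'.1 : ℚ) : ℂ) * (wordOp Λ' t'.2) P Q).sum = 0 := by
    apply List.sum_eq_zero
    intro x hx
    rw [List.mem_map] at hx
    obtain ⟨t', ht', rfl⟩ := hx
    have hrel : wordEq t'.2 t.2 = false := (List.pairwise_append.1 hpw).2.2 t' ht' t List.mem_cons_self
    by_cases heq : t' = t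
    · exfalso; rw [heq, (wordEq_iff _ _).2 rfl] at hrel; exact Bool.noConfusion hrel
    · exact hothers t' (List.mem_append_left _ ht') heq (Or.inl hrel)
  have hp₂ : (p₂.map fun t' => ((t'.1 : ℚ) : ℂ) * (wordOp Λ' t'.2) P Q).sum = 0 := by
    apply List.sum_eq_zero
    intro x hx
    rw [List.mem_map] at hx
    obtain ⟨t', ht', rfl⟩ := hx
    have hrel : wordEq t.2 t'.2 = false :=
      List.rel_of_pairwise_cons (List.pairwise_append.1 hpw).2.1 ht'
    by_cases heq : t' = t
    · exfalso; rw [heq, (wordEq_iff _ _).2 rfl] at hrel; exact Bool.noConfusion hrel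
    · exact hothers t' (List.mem_append_right _ (List.mem_cons_of_mem _ ht')) heq (Or.inr hrel)
  rw [hp₁, hp₂, zero_add, add_zero] at hentry
  -- the diagonal entry of `t` itself is nonzero
  have hM : (wordOp Λ' t.2) P Q ≠ 0 := by
    rw [hw, wordOp_creAnn Λ' cs az hcs has hc ha]
    exact creAnn_apply_self_ne_zero _ _ hPn hQn
  have := mul_eq_zero.1 hentry
  rcases this with h | h
  · exact_mod_cast h
  · exact absurd h hM

/-- **S7 PROVED**: normal words are linearly independent in `𝔄_{Λ'}`. -/
theorem stub_normalWordsIndependent : NormalWordsIndependent := by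
  intro Λ' p hp hpw h0
  suffices H : ∀ n, ∀ t ∈ p, t.2.length < n → t.1 = 0 from fun t ht => H _ t ht (Nat.lt_succ_self _)
  intro n
  induction n with
  | zero => intro t _ h; exact absurd h (Nat.not_lt_zero _)
  | succ n ih =>
    intro t ht hlen
    rcases Nat.lt_succ_iff_lt_or_eq.1 hlen with hlt | heq
    · exact ih t ht hlt
    · exact coeff_zero_step Λ' p hp hpw h0 n ih t ht heq

end Proof

end Summit.Ventures.CertifiedManyBodySolver.Theorems.SymReplay
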